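import Summits.QuantumFields.YangMills.Theorems.BalabanUVNodesN15TwoGridEntry2Smooth
import Summits.QuantumFields.YangMills.Theorems.BalabanUVNodesN15TwoGridHolderStepsDiv
import Summits.QuantumFields.YangMills.Theorems.BalabanUVNodesN15TwoGridMeanValue
import Summits.QuantumFields.YangMills.Theorems.BalabanUVNodesN15TwoGridLandauDefectFull
import Summits.QuantumFields.YangMills.Theorems.BalabanUVNodesN15TwoGridAveragingDefect
import Summits.QuantumFields.YangMills.Theorems.BalabanUVNodesN15TwoGridEntry1Core
import HarnessLib

/-!
# N15 (NE2) — Bałaban's full propagator pair, part 69: ENTRY 2 — the ROUGH pieces `N₃†, N₄†, N₅†` and ★★ `T2 = 𝔇(G∇*)` in (sup → L²-block) currency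

WHO / WHEN.  Cell `pub-ymgap`, seat `pub-ymgap-dag-n15-a` (KNIT-BY-NAME, g13); `--supports stmt-QuantumFields-20507 --as helper` (count-neutral); `HOME/pub-ymgap-dag-n15-a/DOOR-IV-PLAN.md` §7.
Over parts 68 (`hasMaj_entry2_T`), 66 (`hasMaj_divSteps_of_ineq`: ONE coarse step of «G∇*» costs `η^α`), 62 ((1.114) `G∇*∇*`), 61 (`HasMaj.to_l2Blocks`), 57 (`hasMaj_sA_pull_sub`),
53 (`hasMaj_landauDefect_family`), 45 (`hasMaj_qvRe_pull_sub_comp`, `hasMaj_qvAdjRe_sub_pull_comp`, `hasMaj_qvRe_comp`, `hasMaj_qvAdjRe_comp`), 42 ((1.110), `ineq110_114_pair`).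
WHAT.  (§106) `inv_smul_symbOp_sD` (`η∇_κ = s_κ − 1`), `sD_eq_neg_sDbar_mul_sT` (`∇ = −∇*s`).  (§107) ★ `hasMajL2_entry2_of_majorants`: on one torus, from (i) part 68's majorant of
`T2 + N₃† + N₄† − N₅†`, (ii) (1.110) for `Y = G∇_μ*` and `G′`, (iii) the one-step oscillation majorant `A₄` of `Y` (part 66, `A₄ = C₁η^α`), (iv) the Landau defect `V′P − PV` (`A₃`, part 53) and
(v) the fine (1.114) entry `G′∇′*∇′*`: `N₃† = Σ_ν (G′∇′_ν*∇′_ν*)∘s_ν∘[(A_νP − P)Y]` (sharp-prolongation filter defect of part 57 on `Y`, then L² via `√(d+1)`), `N₄† = G′(PV − V′P)Y`,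
`N₅† = −a·G′[𝒬′*(𝒬′P − 𝒬) + (𝒬′* − P𝒬*)𝒬]Y` (part 45's averaging defects on `Y`) — all SUP-small because the only derivative on the rough source sits inside `Y`, whose ONE-STEP oscillation is
`η^α` by (1.111); whence `HasMaj (sup) (L²′) T2 (B·e^{−(ρ∕4)d})` with `B` explicit.  (§108) ★★ `hasMajL2_twoGridDefect_div`: the η-pair of record, `0 < γ < 1`: `∃ δ C > 0 ∀ m_T, k ≥ 1, m, μ`,
`HasMaj (ofBlocks blkFine) (l2Blocks′ η′^D) (idef P P (G′∇′_μ*) (G∇_μ*)) (C·(L^k)^{−γ∕2}·e^{−δ|y−y′|_T})` — ENTRY 2 of [B9] (3.42) in L²-BLOCK output currency, HYPOTHESIS-FREE.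
HONEST FRAMING ∕ LIMITS.  `U ≡ 1` torus family; output norm = L² over unit blocks (the sup version is the sequel, by interpolation with part 66); count-neutral (typed 28∕28 · discharged 5∕27 of
record unchanged); NOT a discharge of N15 (`NE2PlusOperator`, object-bound); not ℝ⁴ ∕ OS ∕ mass gap ∕ Clay.
-/

open scoped BigOperators
open Finset

namespace Summit.QuantumFields.YangMills.BalabanUVNodes.N15.TwoGrid

open Literature.MathematicalPhysics.QuantumFieldTheory.Balaban1983to89
open Literature.MathematicalPhysics.QuantumFieldTheory.Balaban1983to89.B11SectG (BlockNorm HasMaj hasMaj_comp_exp)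
open Literature.MathematicalPhysics.QuantumFieldTheory.Balaban1983to89.T4EtaRateDefect (idef idef_apply)
open Literature.MathematicalPhysics.QuantumFieldTheory.Balaban1983to89.T4EtaRateCoeffDefect (pull pull_apply)
open Literature.MathematicalPhysics.QuantumFieldTheory.Balaban1983to89.B5Prop11Plancherel (Tor fine)
open Literature.MathematicalPhysics.QuantumFieldTheory.Balaban1983to89.B5SettingP12Real (latticeSettingP12R)
open Literature.MathematicalPhysics.QuantumFieldTheory.Balaban1983to89.B5SettingP12Weighted (etaPow etaPow_nonneg)
open Literature.MathematicalPhysics.QuantumFieldTheory.Balaban1983to89.B5SiteBridgeP12 (MP)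
open Literature.MathematicalPhysics.QuantumFieldTheory.Balaban1983to89.B5CoverP12Lattice (Lθ Lθ_nonneg)
open Literature.MathematicalPhysics.QuantumFieldTheory.King1986.Torus (blockOf tdistT tdistT_nonneg tdistT_symm)
open Literature.MathematicalPhysics.QuantumFieldTheory.Balaban1983to89.B6UnitTorusCarrier (unitTorusGeo unitTorusGeo_dist_nonneg triangle254_unitTorusGeo rowSum_unitTorusGeo)
open Summit.QuantumFields.YangMills.BalabanUVNodes.N15.VectorPiece (blkFine kingPrV blkFine_comp_kingPrV)

variable {d : ℕ}

/-! ## §106 Two symbol identities -/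

section Symbols

variable (M : Fin (d + 1) → ℕ) [∀ μ, NeZero (M μ)] (n : ℕ) [NeZero n]

omit [∀ μ, NeZero (M μ)] [NeZero n] in
/-- `c⁻¹·ρ(c(s_κ − 1)) = ρ(s_κ^1 − 1)` (`c ≠ 0`): the scaled difference quotient is the one-step difference. [folklore] -/
theorem inv_smul_symbOp_sD (κ : Fin (d + 1)) {c : ℝ} (hc : c ≠ 0) : c⁻¹ • symbOp M n (sD M n κ c) = symbOp M n (sT M n κ ^ 1 - 1) := by
  rw [sD, map_smul, smul_smul, inv_mul_cancel₀ hc, one_smul, pow_one]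

omit [∀ μ, NeZero (M μ)] [NeZero n] in
/-- `c(s_κ − 1) = −(c(s_κ⁻¹ − 1))·s_κ`: the forward difference is minus the backward difference composed with a shift. [cite: Balaban1984PropagatorsI, (1.31) p.23] -/
theorem sD_eq_neg_sDbar_mul_sT (κ : Fin (d + 1)) (c : ℝ) : sD M n κ c = -((c • (sTinv M n κ - 1)) * sT M n κ ^ 1) := by
  have h := sT_mul_sTinv M n κ
  rw [sD, pow_one, smul_mul_assoc, ← smul_neg, sub_mul, one_mul, mul_comm, h, neg_sub]

end Symbols

/-! ## §107 ★ Entry 2 in (sup → L²-block) currency from the piece majorants -/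

section Core

variable {L : ℕ} [NeZero L] (M : Fin (d + 1) → ℕ) [∀ μ, NeZero (M μ)] (k m : ℕ) (a : ℝ)

/-- ★ **`T2 = 𝔇(G∇_μ*)` ON ONE TORUS FROM THE PIECE MAJORANTS** (all at one rate `ρ > 0`; see the module docstring): the conclusion is
`HasMaj (ofBlocks blkFine) (l2Blocks′ η′^D) T2 (B·e^{−(ρ∕4)|y−y′|_T})` with
`B = B₁ + √(d+1)·[(d+1)·2C₀A₄e^{ρ}K₂ + C₀²A₃K₂K₄ + |a|·C₀(A₄e^{2ρ} + 2e^{2ρ}C₀η)K₂]`, `K₂ = K(ρ∕2)`, `K₄ = K(ρ∕4)`, `η = (L^k)⁻¹`.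
[cite: Balaban1984PropagatorsI, Prop. 1.2 (1.110), (1.111), (1.114) pp.35–36; Balaban1985BackgroundPropagators, Thm 3.1 (3.42) p.397 (entry 2 of the defect list)] -/
theorem hasMajL2_entry2_of_majorants (ha : 0 < a) {K' : ℕ} {C₀ δ₀ : ℝ} {Cα Cε : ℝ → ℝ} {Cαε : ℝ → ℝ → ℝ} (hC₀ : 0 ≤ C₀)
    (HP' : B5.Ineq110_114 (latticeSettingP12R (L ^ m * L ^ k) M a K') C₀ Cα Cε Cαε δ₀) {ρ B₁ A₃ A₄ : ℝ} (hρ : 0 < ρ) (hρδ : ρ ≤ δ₀)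
    (hB₁ : 0 ≤ B₁) (hA₃ : 0 ≤ A₃) (hA₄ : 0 ≤ A₄) (μ : Fin (d + 1))
    (hT : HasMaj (BlockNorm.ofBlocks (unitTorusGeo L k M) (blkFine L k M))
      (BlockNorm.l2Blocks (unitTorusGeo L k M) (fun i : Tor (fine (L ^ m * L ^ k) M) × Fin (d + 1) => blockOf (L ^ m * L ^ k) M i.1)
        (etaPow (L ^ m * L ^ k) (d + 1)) (etaPow_nonneg _ _))
      (idef (pull (kingPrV L k m M)) (pull (kingPrV L k m M))
          (gOp M (L ^ m * L ^ k) a ∘ₗ symbOp M (L ^ m * L ^ k) (((L ^ m * L ^ k : ℕ) : ℝ) • (sTinv M (L ^ m * L ^ k) μ - 1)))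
          (gOp M (L ^ k) a ∘ₗ symbOp M (L ^ k) (((L ^ k : ℕ) : ℝ) • (sTinv M (L ^ k) μ - 1)))
        + gOp M (L ^ m * L ^ k) a ∘ₗ
          (∑ ν : Fin (d + 1), symbOp M (L ^ m * L ^ k) (((L ^ m * L ^ k : ℕ) : ℝ) • (sTinv M (L ^ m * L ^ k) ν - 1)) ∘ₗ
            symbOp M (L ^ m * L ^ k) (sD M (L ^ m * L ^ k) ν ((L ^ m * L ^ k : ℕ) : ℝ)) ∘ₗ symbOp M (L ^ m * L ^ k) (1 - sA M (L ^ m * L ^ k) ν (L ^ m)) ∘ₗ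
              pull (kingPrV L k m M)) ∘ₗ
          gOp M (L ^ k) a ∘ₗ symbOp M (L ^ k) (((L ^ k : ℕ) : ℝ) • (sTinv M (L ^ k) μ - 1))
        + gOp M (L ^ m * L ^ k) a ∘ₗ (pull (kingPrV L k m M) ∘ₗ landauRe M (L ^ k) - landauRe M (L ^ m * L ^ k) ∘ₗ pull (kingPrV L k m M)) ∘ₗ
          gOp M (L ^ k) a ∘ₗ symbOp M (L ^ k) (((L ^ k : ℕ) : ℝ) • (sTinv M (L ^ k) μ - 1))
        - gOp M (L ^ m * L ^ k) a ∘ₗ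
          (pull (kingPrV L k m M) ∘ₗ (a • (qvAdjRe M (L ^ k) ∘ₗ qvRe M (L ^ k))) - (a • (qvAdjRe M (L ^ m * L ^ k) ∘ₗ qvRe M (L ^ m * L ^ k))) ∘ₗ pull (kingPrV L k m M)) ∘ₗ
          gOp M (L ^ k) a ∘ₗ symbOp M (L ^ k) (((L ^ k : ℕ) : ℝ) • (sTinv M (L ^ k) μ - 1)))
      (fun y y' => B₁ * Real.exp (-(ρ / 2 * tdistT M y y'))))
    (hY : HasMaj (BlockNorm.ofBlocks (unitTorusGeo L k M) (blkFine L k M)) (BlockNorm.ofBlocks (unitTorusGeo L k M) (blkFine L k M))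
      (gOp M (L ^ k) a ∘ₗ symbOp M (L ^ k) (((L ^ k : ℕ) : ℝ) • (sTinv M (L ^ k) μ - 1))) (fun y y' => C₀ * Real.exp (-(ρ * tdistT M y y'))))
    (hstep : ∀ κ : Fin (d + 1), HasMaj (BlockNorm.ofBlocks (unitTorusGeo L k M) (blkFine L k M)) (BlockNorm.ofBlocks (unitTorusGeo L k M) (blkFine L k M))
      ((((L ^ k : ℕ) : ℝ)⁻¹ • symbOp M (L ^ k) (sD M (L ^ k) κ ((L ^ k : ℕ) : ℝ))) ∘ₗ (gOp M (L ^ k) a ∘ₗ symbOp M (L ^ k) (((L ^ k : ℕ) : ℝ) • (sTinv M (L ^ k) μ - 1))))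
      (fun y y' => A₄ * Real.exp (-(ρ * tdistT M y y'))))
    (hVd : HasMaj (BlockNorm.ofBlocks (unitTorusGeo L k M) (blkFine L k M))
      (BlockNorm.ofBlocks (unitTorusGeo L k M) (fun i : Tor (fine (L ^ m * L ^ k) M) × Fin (d + 1) => blockOf (L ^ m * L ^ k) M i.1))
      (landauRe M (L ^ m * L ^ k) ∘ₗ pull (kingPrV L k m M) - pull (kingPrV L k m M) ∘ₗ landauRe M (L ^ k)) (fun y y' => A₃ * Real.exp (-(ρ * tdistT M y y')))) :
    HasMaj (BlockNorm.ofBlocks (unitTorusGeo L k M) (blkFine L k M))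
      (BlockNorm.l2Blocks (unitTorusGeo L k M) (fun i : Tor (fine (L ^ m * L ^ k) M) × Fin (d + 1) => blockOf (L ^ m * L ^ k) M i.1)
        (etaPow (L ^ m * L ^ k) (d + 1)) (etaPow_nonneg _ _))
      (idef (pull (kingPrV L k m M)) (pull (kingPrV L k m M))
          (gOp M (L ^ m * L ^ k) a ∘ₗ symbOp M (L ^ m * L ^ k) (((L ^ m * L ^ k : ℕ) : ℝ) • (sTinv M (L ^ m * L ^ k) μ - 1)))
          (gOp M (L ^ k) a ∘ₗ symbOp M (L ^ k) (((L ^ k : ℕ) : ℝ) • (sTinv M (L ^ k) μ - 1))))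
      (fun y y' => (B₁ + Real.sqrt ((d : ℝ) + 1) * (((d : ℝ) + 1) * (2 * C₀ * A₄ * Real.exp ρ * B4Sect5Proof.latticeConst (d + 1) (ρ / 2))
          + C₀ * C₀ * A₃ * B4Sect5Proof.latticeConst (d + 1) (ρ / 2) * B4Sect5Proof.latticeConst (d + 1) (ρ / 4)
          + |a| * C₀ * (A₄ * Real.exp ρ * Real.exp ρ + 2 * Real.exp ρ / ((L ^ k : ℕ) : ℝ) * C₀ * Real.exp ρ) * B4Sect5Proof.latticeConst (d + 1) (ρ / 2)))
        * Real.exp (-(ρ / 4 * tdistT M y y'))) := by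
  classical
  haveI : NeZero (L ^ k) := ⟨pow_ne_zero k (NeZero.ne L)⟩
  haveI : NeZero (L ^ m * L ^ k) := ⟨Nat.mul_ne_zero (pow_ne_zero m (NeZero.ne L)) (pow_ne_zero k (NeZero.ne L))⟩
  have hσ2 : 0 < ρ / 2 := by linarith
  have hσ4 : 0 < ρ / 4 := by linarith
  have hL0 : 0 < L := Nat.pos_of_ne_zero (NeZero.ne L)
  have hn1 : 1 ≤ L ^ k := Nat.one_le_pow _ _ hL0
  have hn'1 : 1 ≤ L ^ m * L ^ k := Nat.one_le_iff_ne_zero.mpr (NeZero.ne _)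
  have hn0 : (0 : ℝ) < ((L ^ k : ℕ) : ℝ) := by exact_mod_cast hn1
  have he0 : 0 ≤ Real.exp ρ := Real.exp_nonneg _
  have hK2 : 0 ≤ B4Sect5Proof.latticeConst (d + 1) (ρ / 2) := B4Sect5Proof.latticeConst_nonneg (d + 1) hσ2.le
  have hK4 : 0 ≤ B4Sect5Proof.latticeConst (d + 1) (ρ / 4) := B4Sect5Proof.latticeConst_nonneg (d + 1) hσ4.le
  have hD0 : 0 ≤ Real.sqrt ((d : ℝ) + 1) := Real.sqrt_nonneg _
  set K₂ := B4Sect5Proof.latticeConst (d + 1) (ρ / 2) with hK₂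
  set K₄ := B4Sect5Proof.latticeConst (d + 1) (ρ / 4) with hK₄
  set bC := BlockNorm.ofBlocks (unitTorusGeo L k M) (blkFine L k M) with hbC
  set bF := BlockNorm.ofBlocks (unitTorusGeo L k M) (fun i : Tor (fine (L ^ m * L ^ k) M) × Fin (d + 1) => blockOf (L ^ m * L ^ k) M i.1) with hbF
  set l2F := BlockNorm.l2Blocks (unitTorusGeo L k M) (fun i : Tor (fine (L ^ m * L ^ k) M) × Fin (d + 1) => blockOf (L ^ m * L ^ k) M i.1)
    (etaPow (L ^ m * L ^ k) (d + 1)) (etaPow_nonneg _ _) with hl2F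
  set Y := gOp M (L ^ k) a ∘ₗ symbOp M (L ^ k) (((L ^ k : ℕ) : ℝ) • (sTinv M (L ^ k) μ - 1)) with hY_def
  set P := pull (kingPrV L k m M) with hP_def
  set G' := gOp M (L ^ m * L ^ k) a with hG'_def
  have hκC : bC.κ = 1 := rfl
  have hκF : bF.κ = 1 := rfl
  have hκ2 : l2F.κ = 1 := rfl
  have hweak : ∀ {C : ℝ} (_ : 0 ≤ C) (y y' : Tor M), C * Real.exp (-(δ₀ * tdistT M y y')) ≤ C * Real.exp (-(ρ * tdistT M y y')) :=
    fun hC y y' => mul_le_mul_of_nonneg_left (Real.exp_le_exp.mpr (by nlinarith [tdistT_nonneg M y y'])) hC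
  have hω : ∀ y : Tor M, etaPow (L ^ m * L ^ k) (d + 1)
      * ((univ.filter fun i : Tor (fine (L ^ m * L ^ k) M) × Fin (d + 1) => blockOf (L ^ m * L ^ k) M i.1 = y).card : ℝ) ≤ (d : ℝ) + 1 :=
    fun y => (etaPow_mul_card_fineBond M (L ^ m * L ^ k) y).le
  have hG' : HasMaj bF bF G' (fun y y' => C₀ * Real.exp (-(ρ * tdistT M y y'))) :=
    (hasMaj_gOp_of_ineq (L := L) M k (L ^ m * L ^ k) a hn'1 HP' hC₀).mono fun y y' => hweak hC₀ y y'
  -- N₄† = G′(PV − V′P)Y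
  have hVd' : HasMaj bC bF (P ∘ₗ landauRe M (L ^ k) - landauRe M (L ^ m * L ^ k) ∘ₗ P) (fun y y' => A₃ * Real.exp (-(ρ * tdistT M y y'))) :=
    hVd.neg.congr fun f => by simp only [LinearMap.sub_apply, neg_sub]
  have hX4 := hasMaj_comp_exp (b₁ := bC) (b₂ := bC) (b₃ := bF) (triangle254_unitTorusGeo L k M) (unitTorusGeo_dist_nonneg L k M) (rowSum_unitTorusGeo L k M hσ2)
    hA₃ hC₀ hσ2.le (by linarith) (by linarith) hVd' hY
  have hN4 := hasMaj_comp_exp (b₁ := bC) (b₂ := bF) (b₃ := bF) (triangle254_unitTorusGeo L k M) (unitTorusGeo_dist_nonneg L k M) (rowSum_unitTorusGeo L k M hσ4)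
    hC₀ (mul_nonneg (mul_nonneg (mul_nonneg bC.κ_nonneg hA₃) hC₀) hK2) hσ4.le (by linarith) (by linarith) hG' hX4
  have hN4l2 := HasMaj.to_l2Blocks (etaPow_nonneg (L ^ m * L ^ k) (d + 1)) hω hN4
  -- N₅† = −a·G′[Q′*(Q′P − Q) + (Q′* − PQ*)Q]Y
  have h4 := hasMaj_qvAdjRe_comp M k (L ^ m * L ^ k) (b₁ := bC) (mul_nonneg hA₄ he0) hρ.le (hasMaj_qvRe_pull_sub_comp M k m (b₁ := bC) hA₄ hρ.le hstep)
  have h5 := hasMaj_qvAdjRe_sub_pull_comp M k m (b₁ := bC) (mul_nonneg hC₀ he0) hρ.le (hasMaj_qvRe_comp M k (L ^ k) (b₁ := bC) hC₀ hρ.le hY)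
  have h45 : HasMaj bC bF
      (qvAdjRe M (L ^ m * L ^ k) ∘ₗ (qvRe M (L ^ m * L ^ k) ∘ₗ P - qvRe M (L ^ k)) ∘ₗ Y + (qvAdjRe M (L ^ m * L ^ k) - P ∘ₗ qvAdjRe M (L ^ k)) ∘ₗ qvRe M (L ^ k) ∘ₗ Y)
      (fun y y' => (A₄ * Real.exp ρ * Real.exp ρ + 2 * Real.exp ρ / ((L ^ k : ℕ) : ℝ) * C₀ * Real.exp ρ) * Real.exp (-(ρ * tdistT M y y'))) :=
    (h4.add h5).mono fun y y' => le_of_eq (by push_cast; ring)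
  have hA45 : 0 ≤ A₄ * Real.exp ρ * Real.exp ρ + 2 * Real.exp ρ / ((L ^ k : ℕ) : ℝ) * C₀ * Real.exp ρ := by positivity
  have hG45 := hasMaj_comp_exp (b₁ := bC) (b₂ := bF) (b₃ := bF) (triangle254_unitTorusGeo L k M) (unitTorusGeo_dist_nonneg L k M) (rowSum_unitTorusGeo L k M hσ2)
    hC₀ hA45 hσ2.le (by linarith) (by linarith) hG' h45
  have hN5 : HasMaj bC bF (G' ∘ₗ (P ∘ₗ (a • (qvAdjRe M (L ^ k) ∘ₗ qvRe M (L ^ k))) - (a • (qvAdjRe M (L ^ m * L ^ k) ∘ₗ qvRe M (L ^ m * L ^ k))) ∘ₗ P) ∘ₗ Y)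
      (fun y y' => |-a| * (bF.κ * C₀ * (A₄ * Real.exp ρ * Real.exp ρ + 2 * Real.exp ρ / ((L ^ k : ℕ) : ℝ) * C₀ * Real.exp ρ) * K₂ * Real.exp (-(ρ / 2 * tdistT M y y')))) := by
    refine (hasMaj_smul_ofBlocks (g := unitTorusGeo L k M) (fun i : Tor (fine (L ^ m * L ^ k) M) × Fin (d + 1) => blockOf (L ^ m * L ^ k) M i.1)
      (fun y y' => mul_nonneg (mul_nonneg (mul_nonneg (mul_nonneg bF.κ_nonneg hC₀) hA45) hK2) (Real.exp_nonneg _)) (-a) hG45).congr fun f => ?_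
    simp only [LinearMap.smul_apply, LinearMap.comp_apply, LinearMap.sub_apply, LinearMap.add_apply, map_sub, map_add, map_smul, smul_sub, smul_add, neg_smul]
    abel
  have hN5l2 := HasMaj.to_l2Blocks (etaPow_nonneg (L ^ m * L ^ k) (d + 1)) hω hN5
  -- N₃† = Σ_ν (G′∇′_ν*∇′_ν*)∘s_ν∘[(A_νP − P)Y]
  have hZ : ∀ ν : Fin (d + 1), HasMaj bC bF ((symbOp M (L ^ m * L ^ k) (sA M (L ^ m * L ^ k) ν (L ^ m)) ∘ₗ P - P) ∘ₗ Y)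
      (fun y y' => A₄ * Real.exp (-(ρ * tdistT M y y'))) := fun ν => hasMaj_sA_pull_sub M k m hA₄ ν (hstep ν)
  have hZ2 : ∀ ν : Fin (d + 1), HasMaj bC l2F (symbOp M (L ^ m * L ^ k) (sT M (L ^ m * L ^ k) ν ^ 1) ∘ₗ ((symbOp M (L ^ m * L ^ k) (sA M (L ^ m * L ^ k) ν (L ^ m)) ∘ₗ P - P) ∘ₗ Y))
      (fun y y' => 2 * (Real.sqrt ((d : ℝ) + 1) * A₄) * Real.exp ρ * Real.exp (-(ρ * tdistT M y y'))) := fun ν =>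
    hasMajL2_sT_pow_comp M k (L ^ m * L ^ k) (etaPow_nonneg _ _) (mul_nonneg hD0 hA₄) hρ.le ν hn'1 ((HasMaj.to_l2Blocks (etaPow_nonneg _ _) hω (hZ ν)).mono fun y y' => le_of_eq (mul_assoc _ _ _).symm)
  have h5' : ∀ ν : Fin (d + 1), HasMaj l2F l2F
      (G' ∘ₗ symbOp M (L ^ m * L ^ k) (((L ^ m * L ^ k : ℕ) : ℝ) • (sTinv M (L ^ m * L ^ k) ν - 1)) ∘ₗ
        symbOp M (L ^ m * L ^ k) (((L ^ m * L ^ k : ℕ) : ℝ) • (sTinv M (L ^ m * L ^ k) ν - 1))) (fun y y' => C₀ * Real.exp (-(ρ * tdistT M y y'))) := fun ν =>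
    (hasMajL2_divAdj2_of_ineq (L := L) M k (L ^ m * L ^ k) a hn'1 HP' hC₀ ν ν).mono fun y y' => hweak hC₀ y y'
  have hW : ∀ ν : Fin (d + 1), HasMaj bC l2F
      ((G' ∘ₗ symbOp M (L ^ m * L ^ k) (((L ^ m * L ^ k : ℕ) : ℝ) • (sTinv M (L ^ m * L ^ k) ν - 1)) ∘ₗ
        symbOp M (L ^ m * L ^ k) (((L ^ m * L ^ k : ℕ) : ℝ) • (sTinv M (L ^ m * L ^ k) ν - 1))) ∘ₗ
        (symbOp M (L ^ m * L ^ k) (sT M (L ^ m * L ^ k) ν ^ 1) ∘ₗ ((symbOp M (L ^ m * L ^ k) (sA M (L ^ m * L ^ k) ν (L ^ m)) ∘ₗ P - P) ∘ₗ Y)))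
      (fun y y' => l2F.κ * C₀ * (2 * (Real.sqrt ((d : ℝ) + 1) * A₄) * Real.exp ρ) * K₂ * Real.exp (-(ρ / 2 * tdistT M y y'))) := fun ν =>
    hasMaj_comp_exp (b₁ := bC) (b₂ := l2F) (b₃ := l2F) (triangle254_unitTorusGeo L k M) (unitTorusGeo_dist_nonneg L k M) (rowSum_unitTorusGeo L k M hσ2)
      hC₀ (by positivity) hσ2.le (by linarith) (by linarith) (h5' ν) (hZ2 ν)
  have hN3sum := hasMaj_finsum (g := unitTorusGeo L k M) univ _ _ fun ν _ => hW ν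
  have hsymb : ∀ ν : Fin (d + 1), symbOp M (L ^ m * L ^ k) (sD M (L ^ m * L ^ k) ν ((L ^ m * L ^ k : ℕ) : ℝ))
      = -(symbOp M (L ^ m * L ^ k) (((L ^ m * L ^ k : ℕ) : ℝ) • (sTinv M (L ^ m * L ^ k) ν - 1)) ∘ₗ symbOp M (L ^ m * L ^ k) (sT M (L ^ m * L ^ k) ν ^ 1)) := fun ν => by
    rw [sD_eq_neg_sDbar_mul_sT, map_neg, map_mul, Module.End.mul_eq_comp]
  have hN3 : HasMaj bC l2F
      (G' ∘ₗ (∑ ν : Fin (d + 1), symbOp M (L ^ m * L ^ k) (((L ^ m * L ^ k : ℕ) : ℝ) • (sTinv M (L ^ m * L ^ k) ν - 1)) ∘ₗ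
          symbOp M (L ^ m * L ^ k) (sD M (L ^ m * L ^ k) ν ((L ^ m * L ^ k : ℕ) : ℝ)) ∘ₗ symbOp M (L ^ m * L ^ k) (1 - sA M (L ^ m * L ^ k) ν (L ^ m)) ∘ₗ P) ∘ₗ Y)
      (fun y y' => ∑ ν : Fin (d + 1), l2F.κ * C₀ * (2 * (Real.sqrt ((d : ℝ) + 1) * A₄) * Real.exp ρ) * K₂ * Real.exp (-(ρ / 2 * tdistT M y y'))) := by
    refine hN3sum.congr fun f => ?_
    simp only [LinearMap.sum_apply, LinearMap.comp_apply, map_sum, hsymb, LinearMap.neg_apply, LinearMap.neg_comp, LinearMap.sub_apply, map_sub, map_one,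
      Module.End.one_apply, neg_sub]
  -- assembly: T2 = (T2 + N₃† + N₄† − N₅†) − N₃† − N₄† + N₅†
  refine ((((hT.sub hN3).sub hN4l2).add hN5l2).congr fun f => ?_).mono fun y y' => ?_
  · simp only [LinearMap.add_apply, LinearMap.sub_apply]
    abel
  · simp only [hκC, hκF, hκ2]
    rw [sum_const, card_univ, Fintype.card_fin, nsmul_eq_mul, abs_neg]
    have hE2 : Real.exp (-(ρ / 2 * tdistT M y y')) ≤ Real.exp (-(ρ / 4 * tdistT M y y')) := Real.exp_le_exp.mpr (by nlinarith [tdistT_nonneg M y y'])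
    have hE4 := Real.exp_nonneg (-(ρ / 4 * tdistT M y y'))
    have ha0 := abs_nonneg a
    calc B₁ * Real.exp (-(ρ / 2 * tdistT M y y'))
          + ((d + 1 : ℕ) : ℝ) * (1 * C₀ * (2 * (Real.sqrt ((d : ℝ) + 1) * A₄) * Real.exp ρ) * K₂ * Real.exp (-(ρ / 2 * tdistT M y y')))
          + Real.sqrt ((d : ℝ) + 1) * (1 * C₀ * (1 * A₃ * C₀ * K₂) * K₄ * Real.exp (-(ρ / 4 * tdistT M y y')))
          + Real.sqrt ((d : ℝ) + 1) * (|a| * (1 * C₀ * (A₄ * Real.exp ρ * Real.exp ρ + 2 * Real.exp ρ / ((L ^ k : ℕ) : ℝ) * C₀ * Real.exp ρ) * K₂ * Real.exp (-(ρ / 2 * tdistT M y y'))))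
        ≤ B₁ * Real.exp (-(ρ / 4 * tdistT M y y'))
          + ((d + 1 : ℕ) : ℝ) * (1 * C₀ * (2 * (Real.sqrt ((d : ℝ) + 1) * A₄) * Real.exp ρ) * K₂ * Real.exp (-(ρ / 4 * tdistT M y y')))
          + Real.sqrt ((d : ℝ) + 1) * (1 * C₀ * (1 * A₃ * C₀ * K₂) * K₄ * Real.exp (-(ρ / 4 * tdistT M y y')))
          + Real.sqrt ((d : ℝ) + 1) * (|a| * (1 * C₀ * (A₄ * Real.exp ρ * Real.exp ρ + 2 * Real.exp ρ / ((L ^ k : ℕ) : ℝ) * C₀ * Real.exp ρ) * K₂ * Real.exp (-(ρ / 4 * tdistT M y y')))) := by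
          gcongr
      _ = _ := by push_cast; ring

end Core

/-! ## §108 ★★ ENTRY 2 in (sup → L²-block) currency on the η-pair of record, hypothesis-free -/

section Family

variable {L : ℕ} [NeZero L]

/-- the a-priori (no-rate) majorant of `T2 = 𝔇(G∇_μ*)` in (sup → L²-block) currency: `2√(d+1)·C·e^{δ₀}` from (1.110) «G∇*J» on both members (used for `L^k < 4`).
[cite: Balaban1984PropagatorsI, Prop. 1.2 (1.110) p.35] -/
theorem hasMajL2_entry2_apriori (M : Fin (d + 1) → ℕ) [∀ μ, NeZero (M μ)] (k m : ℕ) (a : ℝ) (μ : Fin (d + 1)) {K : ℕ} {K' : ℕ} {C δ₀ : ℝ}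
    {Cα Cε : ℝ → ℝ} {Cαε : ℝ → ℝ → ℝ} (hC : 0 ≤ C)
    (H1 : B5.Ineq110_114 (latticeSettingP12R (L ^ k) M a K) C Cα Cε Cαε δ₀) (H2 : B5.Ineq110_114 (latticeSettingP12R (L ^ m * L ^ k) M a K') C Cα Cε Cαε δ₀) :
    HasMaj (BlockNorm.ofBlocks (unitTorusGeo L k M) (blkFine L k M))
      (BlockNorm.l2Blocks (unitTorusGeo L k M) (fun i : Tor (fine (L ^ m * L ^ k) M) × Fin (d + 1) => blockOf (L ^ m * L ^ k) M i.1)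
        (etaPow (L ^ m * L ^ k) (d + 1)) (etaPow_nonneg _ _))
      (idef (pull (kingPrV L k m M)) (pull (kingPrV L k m M))
        (gOp M (L ^ m * L ^ k) a ∘ₗ symbOp M (L ^ m * L ^ k) (((L ^ m * L ^ k : ℕ) : ℝ) • (sTinv M (L ^ m * L ^ k) μ - 1)))
        (gOp M (L ^ k) a ∘ₗ symbOp M (L ^ k) (((L ^ k : ℕ) : ℝ) • (sTinv M (L ^ k) μ - 1))))
      (fun y y' => Real.sqrt ((d : ℝ) + 1) * (2 * C) * Real.exp (-(δ₀ * tdistT M y y'))) := by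
  classical
  haveI : NeZero (L ^ m * L ^ k) := ⟨Nat.mul_ne_zero (pow_ne_zero m (NeZero.ne L)) (pow_ne_zero k (NeZero.ne L))⟩
  have hL0 : 0 < L := Nat.pos_of_ne_zero (NeZero.ne L)
  have hn1 : 1 ≤ L ^ k := Nat.one_le_pow _ _ hL0
  have hn'1 : 1 ≤ L ^ m * L ^ k := Nat.one_le_iff_ne_zero.mpr (NeZero.ne _)
  have hK0 : ∀ y y' : Tor M, 0 ≤ C * Real.exp (-(δ₀ * tdistT M y y')) := fun y y' => mul_nonneg hC (Real.exp_nonneg _)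
  have hf := hasMaj_comp_pull_kingPrV M k m hK0 (hasMaj_gDivAdj_of_ineq (L := L) (k := k) M (L ^ m * L ^ k) a hn'1 H2 hC μ)
  have hc := hasMaj_pull_comp₂ (g := unitTorusGeo L k M) (b₁ := BlockNorm.ofBlocks (unitTorusGeo L k M) (blkFine L k M)) (blkFine L k M)
    (fun i : Tor (fine (L ^ m * L ^ k) M) × Fin (d + 1) => blockOf (L ^ m * L ^ k) M i.1) (kingPrV L k m M) hK0
    (fun x y' => by rw [show blkFine L k M (kingPrV L k m M x) = blockOf (L ^ m * L ^ k) M x.1 from congrFun (blkFine_comp_kingPrV M L k m) x])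
    (hasMaj_gDivAdj_of_ineq (L := L) (k := k) M (L ^ k) a hn1 H1 hC μ)
  have hω : ∀ y : Tor M, etaPow (L ^ m * L ^ k) (d + 1)
      * ((univ.filter fun i : Tor (fine (L ^ m * L ^ k) M) × Fin (d + 1) => blockOf (L ^ m * L ^ k) M i.1 = y).card : ℝ) ≤ (d : ℝ) + 1 :=
    fun y => (etaPow_mul_card_fineBond M (L ^ m * L ^ k) y).le
  rw [idef]
  refine (HasMaj.to_l2Blocks (etaPow_nonneg _ _) hω ((hf.congr fun μ => rfl).sub hc)).mono fun y y' => le_of_eq (by ring)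

/-- ★★ **ENTRY 2 OF [B9] (3.42) FOR BAŁABAN's FULL LANDAU-GAUGE PAIR `(G′, G)` AT `U ≡ 1`, L²-BLOCK OUTPUT CURRENCY, HYPOTHESIS-FREE**: for odd `L ≥ 3`, `a > 0`, `0 < γ < 1` there are
`δ, C > 0` such that for EVERY torus exponent `m_T`, EVERY coarse scale `k ≥ 1`, EVERY refinement exponent `m` and every direction `μ`, the two-grid defect of «G∇*»,
`T2_μ = 𝔇(G∇_μ*) = G′∇′_μ*P − PG∇_μ* = idef P P (G′∘ρ′(n′(s_μ⁻¹−1))) (G∘ρ(n(s_μ⁻¹−1)))` — the derivative on the ROUGH (sup-normed, block-localised) source — has the majorant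
`C·(L^k)^{−γ∕2}·e^{−δ|y−y′|_T}` from coarse 1-forms in King's unit blocks (sup) to fine 1-forms measured in `L²(unit block, η′^{d+1})`.  Inputs (all tree theorems): parts 68, 66, 62, 57, 53, 45,
42; rate = `min(η, η^{γ∕2}·(1.111), (L^k)^{−γ∕2}·Landau defect)`; `L^k < 4` by the a-priori bound.  The sup-output version (interpolation with part 66) and the binder-free readout are the sequels.
[cite: Balaban1985BackgroundPropagators, Thm 3.1 (3.42) p.397 (the entry G∇*); Balaban1984PropagatorsI, Prop. 1.2 (1.110)–(1.114) pp.35–36] -/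
theorem hasMajL2_twoGridDefect_div (hLodd : Odd L) (hL2 : 2 ≤ L) {a : ℝ} (ha : 0 < a) {γ : ℝ} (hγ0 : 0 < γ) (hγ1 : γ < 1) :
    ∃ δ C : ℝ, 0 < δ ∧ 0 < C ∧ ∀ (mT k m : ℕ) (hk : 1 ≤ k) (hL : Odd L ∧ 1 < L) (μ : Fin (d + 1)),
      HasMaj (BlockNorm.ofBlocks (unitTorusGeo L k (MP (paramsOf d L mT k hL))) (blkFine L k (MP (paramsOf d L mT k hL))))
        (BlockNorm.l2Blocks (unitTorusGeo L k (MP (paramsOf d L mT k hL)))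
          (fun i : Tor (fine (L ^ m * L ^ k) (MP (paramsOf d L mT k hL))) × Fin (d + 1) => blockOf (L ^ m * L ^ k) (MP (paramsOf d L mT k hL)) i.1)
          (etaPow (L ^ m * L ^ k) (d + 1)) (etaPow_nonneg _ _))
        (idef (pull (kingPrV L k m (MP (paramsOf d L mT k hL)))) (pull (kingPrV L k m (MP (paramsOf d L mT k hL))))
          (gOp (MP (paramsOf d L mT k hL)) (L ^ m * L ^ k) a ∘ₗ
            symbOp (MP (paramsOf d L mT k hL)) (L ^ m * L ^ k) (((L ^ m * L ^ k : ℕ) : ℝ) • (sTinv (MP (paramsOf d L mT k hL)) (L ^ m * L ^ k) μ - 1)))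
          (gOp (MP (paramsOf d L mT k hL)) (L ^ k) a ∘ₗ symbOp (MP (paramsOf d L mT k hL)) (L ^ k) (((L ^ k : ℕ) : ℝ) • (sTinv (MP (paramsOf d L mT k hL)) (L ^ k) μ - 1))))
        (fun y y' => C * ((L ^ k : ℕ) : ℝ) ^ (-(γ / 2)) * Real.exp (-(δ * tdistT (MP (paramsOf d L mT k hL)) y y'))) := by
  classical
  have hL : Odd L ∧ 1 < L := ⟨hLodd, by omega⟩
  have hL0 : 0 < L := by omega
  have hα0 : 0 ≤ γ / 2 := by linarith
  have hα1 : γ / 2 < 1 := by linarith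
  obtain ⟨δ₅, C₀, Cα, Cε, Cαε, hδ₅, hC₀, H5⟩ := ineq110_114_pair (d := d) hL ha
  obtain ⟨δV, CV, hδV, hCV, HV⟩ := hasMaj_landauDefect_family (d := d) hLodd hL2 ha hγ0 hγ1
  set ρ : ℝ := min δ₅ δV with hρdef
  have hρ : 0 < ρ := lt_min hδ₅ hδV
  have hρ5 : ρ ≤ δ₅ := min_le_left _ _
  have hρV : ρ ≤ δV := min_le_right _ _
  obtain ⟨C₁, hC₁⟩ : ∃ C₁ : ℝ, C₁ = |Cα (γ / 2)| * (Lθ (d + 1) + 1) * Real.exp δ₅ := ⟨_, rfl⟩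
  have hC₁0 : 0 ≤ C₁ := by rw [hC₁]; exact mul_nonneg (mul_nonneg (abs_nonneg _) (by linarith [Lθ_nonneg (d + 1)])) (Real.exp_nonneg _)
  obtain ⟨K₂, hK₂⟩ : ∃ K₂ : ℝ, K₂ = B4Sect5Proof.latticeConst (d + 1) (ρ / 2) := ⟨_, rfl⟩
  obtain ⟨K₄, hK₄⟩ : ∃ K₄ : ℝ, K₄ = B4Sect5Proof.latticeConst (d + 1) (ρ / 4) := ⟨_, rfl⟩
  have hK2 : 0 ≤ K₂ := by rw [hK₂]; exact B4Sect5Proof.latticeConst_nonneg (d + 1) (by linarith)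
  have hK4 : 0 ≤ K₄ := by rw [hK₄]; exact B4Sect5Proof.latticeConst_nonneg (d + 1) (by linarith)
  obtain ⟨D1, hD1⟩ : ∃ D1 : ℝ, D1 = Real.sqrt ((d : ℝ) + 1) := ⟨_, rfl⟩
  have hD1' : 0 ≤ D1 := by rw [hD1]; exact Real.sqrt_nonneg _
  obtain ⟨E₁, hE₁⟩ : ∃ E₁ : ℝ, E₁ = Real.exp ρ * C₀ * (1 + ((d : ℝ) + 1) * C₀ * K₂) := ⟨_, rfl⟩
  have hE₁0 : 0 ≤ E₁ := by rw [hE₁]; positivity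
  obtain ⟨Cbig, hCbig⟩ : ∃ Cbig : ℝ, Cbig = D1 * E₁ + D1 * (((d : ℝ) + 1) * (2 * C₀ * C₁ * Real.exp ρ * K₂) + C₀ * C₀ * CV * K₂ * K₄
      + |a| * C₀ * (C₁ * Real.exp ρ * Real.exp ρ + 2 * Real.exp ρ * C₀ * Real.exp ρ) * K₂) + D1 * (2 * C₀) * 2 := ⟨_, rfl⟩
  have hCbig0 : 0 ≤ Cbig := by rw [hCbig]; positivity
  refine ⟨ρ / 4, Cbig + 1, by linarith, by positivity, fun mT k m hk hL' μ => ?_⟩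
  set M : Fin (d + 1) → ℕ := MP (paramsOf d L mT k hL') with hM
  haveI : NeZero (L ^ k) := ⟨pow_ne_zero k (by omega)⟩
  have hM2 : ∀ μ, 2 ≤ M μ := fun μ => Nat.le_mul_of_pos_right 2 (pow_pos hL0 mT)
  have hn1 : 1 ≤ L ^ k := Nat.one_le_pow _ _ hL0
  have hn0 : (0 : ℝ) < ((L ^ k : ℕ) : ℝ) := by exact_mod_cast hn1
  have hnr1 : (1 : ℝ) ≤ ((L ^ k : ℕ) : ℝ) := by exact_mod_cast hn1
  obtain ⟨r, hr⟩ : ∃ r : ℝ, r = ((L ^ k : ℕ) : ℝ) ^ (-(γ / 2)) := ⟨_, rfl⟩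
  have hr0 : 0 ≤ r := by rw [hr]; exact Real.rpow_nonneg hn0.le _
  have hηr : ((L ^ k : ℕ) : ℝ)⁻¹ ≤ r := by
    rw [hr, Real.rpow_neg hn0.le, ← Real.rpow_neg_one, Real.rpow_neg hn0.le, Real.rpow_one]
    exact inv_anti₀ (Real.rpow_pos_of_pos hn0 _) ((Real.rpow_le_rpow_of_exponent_le hnr1 (by linarith : γ / 2 ≤ 1)).trans (by rw [Real.rpow_one]))
  have hE : ∀ y y' : Tor M, 0 ≤ Real.exp (-(ρ / 4 * tdistT M y y')) := fun _ _ => Real.exp_nonneg _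
  have hweak : ∀ {C δ' : ℝ} (_ : 0 ≤ C) (_ : ρ / 4 ≤ δ') (y y' : Tor M), C * Real.exp (-(δ' * tdistT M y y')) ≤ C * Real.exp (-(ρ / 4 * tdistT M y y')) :=
    fun hC hδ' y y' => mul_le_mul_of_nonneg_left (Real.exp_le_exp.mpr (neg_le_neg (mul_le_mul_of_nonneg_right hδ' (tdistT_nonneg M y y')))) hC
  have HP := (H5 mT k m hk).1
  have HP' := (H5 mT k m hk).2
  by_cases hn4 : 4 ≤ L ^ k
  · -- the pieces
    have hY : HasMaj (BlockNorm.ofBlocks (unitTorusGeo L k M) (blkFine L k M)) (BlockNorm.ofBlocks (unitTorusGeo L k M) (blkFine L k M))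
        (gOp M (L ^ k) a ∘ₗ symbOp M (L ^ k) (((L ^ k : ℕ) : ℝ) • (sTinv M (L ^ k) μ - 1))) (fun y y' => C₀ * Real.exp (-(ρ * tdistT M y y'))) :=
      (hasMaj_gDivAdj_of_ineq (L := L) (k := k) M (L ^ k) a hn1 HP hC₀.le μ).mono fun y y' =>
        mul_le_mul_of_nonneg_left (Real.exp_le_exp.mpr (neg_le_neg (mul_le_mul_of_nonneg_right hρ5 (tdistT_nonneg M y y')))) hC₀.le
    have hstep : ∀ κ : Fin (d + 1), HasMaj (BlockNorm.ofBlocks (unitTorusGeo L k M) (blkFine L k M)) (BlockNorm.ofBlocks (unitTorusGeo L k M) (blkFine L k M))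
        ((((L ^ k : ℕ) : ℝ)⁻¹ • symbOp M (L ^ k) (sD M (L ^ k) κ ((L ^ k : ℕ) : ℝ))) ∘ₗ (gOp M (L ^ k) a ∘ₗ symbOp M (L ^ k) (((L ^ k : ℕ) : ℝ) • (sTinv M (L ^ k) μ - 1))))
        (fun y y' => C₁ * r * Real.exp (-(ρ * tdistT M y y'))) := by
      intro κ
      rw [inv_smul_symbOp_sD M (L ^ k) κ hn0.ne']
      have h := hasMaj_divSteps_of_ineq (L := L) (k := k) M (L ^ k) a hM2 (j := 1) (by omega) HP hδ₅.le hα0 hα1 κ μ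
      have hr' : (((1 : ℕ) : ℝ) / ((L ^ k : ℕ) : ℝ)) ^ (γ / 2) = r := by
        rw [Nat.cast_one, one_div, Real.inv_rpow hn0.le, hr, Real.rpow_neg hn0.le]
      have e1 : |Cα (γ / 2)| * (Lθ (d + 1) + 1) * Real.exp δ₅ * (((1 : ℕ) : ℝ) / ((L ^ k : ℕ) : ℝ)) ^ (γ / 2) = C₁ * r := by rw [hr', hC₁]
      refine h.mono fun y y' => ?_
      exact mul_le_mul e1.le (Real.exp_le_exp.mpr (neg_le_neg (mul_le_mul_of_nonneg_right hρ5 (tdistT_nonneg M y y')))) (Real.exp_nonneg _) (mul_nonneg hC₁0 hr0)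
    have hT := hasMaj_entry2_T (L := L) M k m a ha hC₀.le HP HP' hρ hρ5 μ
    have hmain := hasMajL2_entry2_of_majorants (L := L) M k m a ha hC₀.le HP' hρ hρ5 (B₁ := D1 * (((L ^ k : ℕ) : ℝ)⁻¹ * E₁))
      (A₃ := CV * r) (A₄ := C₁ * r) (by positivity) (mul_nonneg hCV.le hr0) (mul_nonneg hC₁0 hr0) μ
      (hT.mono fun y y' => le_of_eq (by rw [hD1, hE₁, hK₂]; ring)) hY hstep
      ((HV mT k m hk hL').mono fun y y' => by
        rw [hr]
        exact mul_le_mul_of_nonneg_left (Real.exp_le_exp.mpr (neg_le_neg (mul_le_mul_of_nonneg_right hρV (tdistT_nonneg M y y'))))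
          (mul_nonneg hCV.le (Real.rpow_nonneg hn0.le _)))
    refine hmain.mono fun y y' => mul_le_mul_of_nonneg_right ?_ (hE y y')
    rw [← hD1, ← hK₂, ← hK₄, ← hr]
    -- the constant: every piece carries a factor `≤ r`
    have h1 : D1 * (((L ^ k : ℕ) : ℝ)⁻¹ * E₁) ≤ D1 * E₁ * r :=
      calc D1 * (((L ^ k : ℕ) : ℝ)⁻¹ * E₁) = D1 * E₁ * ((L ^ k : ℕ) : ℝ)⁻¹ := by ring
        _ ≤ D1 * E₁ * r := mul_le_mul_of_nonneg_left hηr (mul_nonneg hD1' hE₁0)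
    have h2 : 2 * Real.exp ρ / ((L ^ k : ℕ) : ℝ) * C₀ * Real.exp ρ ≤ 2 * Real.exp ρ * C₀ * Real.exp ρ * r :=
      calc 2 * Real.exp ρ / ((L ^ k : ℕ) : ℝ) * C₀ * Real.exp ρ = 2 * Real.exp ρ * C₀ * Real.exp ρ * ((L ^ k : ℕ) : ℝ)⁻¹ := by ring
        _ ≤ 2 * Real.exp ρ * C₀ * Real.exp ρ * r := mul_le_mul_of_nonneg_left hηr (by positivity)
    calc D1 * (((L ^ k : ℕ) : ℝ)⁻¹ * E₁) + D1 * (((d : ℝ) + 1) * (2 * C₀ * (C₁ * r) * Real.exp ρ * K₂) + C₀ * C₀ * (CV * r) * K₂ * K₄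
            + |a| * C₀ * (C₁ * r * Real.exp ρ * Real.exp ρ + 2 * Real.exp ρ / ((L ^ k : ℕ) : ℝ) * C₀ * Real.exp ρ) * K₂)
        ≤ D1 * E₁ * r + D1 * (((d : ℝ) + 1) * (2 * C₀ * (C₁ * r) * Real.exp ρ * K₂) + C₀ * C₀ * (CV * r) * K₂ * K₄
            + |a| * C₀ * (C₁ * r * Real.exp ρ * Real.exp ρ + 2 * Real.exp ρ * C₀ * Real.exp ρ * r) * K₂) := by
          gcongr
      _ = Cbig * r - D1 * (2 * C₀) * 2 * r := by rw [hCbig]; ring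
      _ ≤ (Cbig + 1) * r := by nlinarith [mul_nonneg (mul_nonneg hD1' (mul_nonneg zero_le_two hC₀.le)) hr0]
  · -- `L^k < 4`: the a-priori bound, `1 ≤ 2r`
    have hap := hasMajL2_entry2_apriori (L := L) M k m a μ hC₀.le HP HP'
    have hr2 : 1 ≤ 2 * r := by
      have hn4' : ((L ^ k : ℕ) : ℝ) ≤ 4 := by exact_mod_cast (by omega : L ^ k ≤ 4)
      have h4 : (4 : ℝ) ^ (-(γ / 2)) ≤ r := by
        rw [hr, Real.rpow_neg (by norm_num), Real.rpow_neg hn0.le]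
        exact inv_anti₀ (Real.rpow_pos_of_pos hn0 _) (Real.rpow_le_rpow hn0.le hn4' hα0)
      have h4' : (1 / 2 : ℝ) ≤ (4 : ℝ) ^ (-(γ / 2)) := by
        have e : (4 : ℝ) ^ (-(γ / 2)) = ((2 : ℝ) ^ γ)⁻¹ := by
          rw [show (4 : ℝ) = 2 ^ (2 : ℝ) by norm_num, ← Real.rpow_mul (by norm_num), show (2 : ℝ) * -(γ / 2) = -γ by ring, Real.rpow_neg (by norm_num)]
        have h2γ : (2 : ℝ) ^ γ ≤ 2 := (Real.rpow_le_rpow_of_exponent_le (by norm_num : (1 : ℝ) ≤ 2) hγ1.le).trans (by rw [Real.rpow_one])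
        rw [e, one_div]
        exact inv_anti₀ (Real.rpow_pos_of_pos (by norm_num) _) h2γ
      linarith
    refine hap.mono fun y y' => ?_
    rw [← hD1, ← hr]
    calc D1 * (2 * C₀) * Real.exp (-(δ₅ * tdistT M y y')) ≤ D1 * (2 * C₀) * Real.exp (-(ρ / 4 * tdistT M y y')) :=
          hweak (by positivity) (by linarith) y y'
      _ ≤ D1 * (2 * C₀) * (2 * r) * Real.exp (-(ρ / 4 * tdistT M y y')) := by
          have h0 : 0 ≤ D1 * (2 * C₀) * Real.exp (-(ρ / 4 * tdistT M y y')) := by positivity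
          nlinarith
      _ = (D1 * (2 * C₀) * 2) * r * Real.exp (-(ρ / 4 * tdistT M y y')) := by ring
      _ ≤ (Cbig + 1) * r * Real.exp (-(ρ / 4 * tdistT M y y')) := by
          refine mul_le_mul_of_nonneg_right (mul_le_mul_of_nonneg_right ?_ hr0) (hE y y')
          have hX : 0 ≤ D1 * E₁ + D1 * (((d : ℝ) + 1) * (2 * C₀ * C₁ * Real.exp ρ * K₂) + C₀ * C₀ * CV * K₂ * K₄
              + |a| * C₀ * (C₁ * Real.exp ρ * Real.exp ρ + 2 * Real.exp ρ * C₀ * Real.exp ρ) * K₂) := by positivity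
          rw [hCbig]; linarith

end Family

end Summit.QuantumFields.YangMills.BalabanUVNodes.N15.TwoGrid
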